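import Summits.Schanuel.Schanuel.Theorems.RootDecomp1KSiegelGenusOne04

/-!
# RootDecomp1KSiegelGenusOne — lens 1, generation 61, NODE 22 «SIEGEL ON THE K-LINE» (the genus-one class SW e := (Y⁴−17)x² + (Y²+17Y−17)x + e: Weierstrass model over ℚ(θ), θ⁴ = 17, X_E-stable integral lattice, Siegel's theorem for S-integral points — PROVED in the tree — ⇒ finitely many level ordinates/abscissae ⇒ LevelFinite / ThinFibreAt for every e with dQ e ≠ 0; the pinned K-R52-territory family S' j; RULE K-R40 (ii-b) / K-R52 (iii) payable clause; CLAIM L2826, PRICE L2834, REPAIR L2845, K-R53) — continuation (RootDecomp1KSiegelGenusOne05): §E TERRITORY: Δ_x(SW e) 17-Eisenstein, the resolvent certificate mod 11, S'_territory by tree names (section Territory)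

(lens-1 g61 NODE 22 HOME kernel K = HOME/decomp-schanuel-lens-1/g61/lean/SiegelGenusOne.lean 7349a68e…, 1342 l, 168 theorems + 52 defs; imports the tree port …RootDecomp1KOddEmpty05 + the three BUILT PROVED Literature modules Literature.NumberTheory.DiophantineGeometry.{SiegelIntegralPointsReduction, SiegelCubicReduction, UnitEquationFinite} (standard axioms; the assembly …SiegelIntegralPointsProofs is not imported — Siegel's theorem `WeierstrassCurve.siegel_finite_integralPoints K` is re-assembled INLINE as a local `have`, no top-level twin); no private, no instance, no set_option, no notation, no sorry, no native_decide (`decide` only on closed ZMod / numeral goals); CLAIM L2826, census LIVENESS-v20/v22/v23 (rows S 0 / S 1 / S′ X=937 / S′ X=22442 / SW(−342); keys genus / rescub / jroot / tors / frob / oddempty / locsol / real of record L2835/L2852/L2856), crit g11 EX-ANTE PRICE L2834 (as filed NOT PAYABLE — S_j, j ≥ 1, real-dead —; PAYABLE ON REPAIR: THEOREM ×1 for (E)+(W)+(F)+(T) JOINTLY on CHECKLIST K-g61 (1)–(11); RULE K-R53 pre-announced, clause (ii-ℝ) effective), lens REPAIR L2845 (class SW(e′_j), anchor (X_j, 3)),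 crit REPLY/PRICE-CONFIRMATION L2849 + ERRATUM L2852 (pin X_j = 21505j + 937; PRICE STANDS), writer g32 NOTES 2/8/10 (pre-kernel arithmetic), NODE L2861 / REQUEST L2862, critic VERDICT L2864 (crit g11): CLEARED — THEOREM ×1 for (E)+(W)+(F)+(T) JOINTLY, ONE credit (engine `levelFinite_SW (e) (hd : dQ e ≠ 0)` by the tree's PROVED Siegel theorem assembled inline; class `S' j = SW (−64·X_j² − 43·X_j)`, `X_j = 21505j + 937`, real-live at every level, K-R51-certified uniformly via the pins 5 / 11 / 23); CHECKLIST K-g61 (1)–(11) met item by item (K rc 0 · 0 errors · 0 sorries; Probe rc 0 with 263 `#print axioms` guards all standard; Ctrl0 rc 0; Ctrl rc 1 with exactly the 46 planted errors; tokens: sorry / native_decide / private / instance / set_option / structure / fact-def all 0, `SiegelClause` only in conclusion position); LABEL OF RECORD: literature KNOWN TOOL (Siegel 1929 genus one / AEC IX.3.2.2 base change) · problem-relative NEW LEVER on the K-line (first global finiteness theorem; first PROVED binder-class input, `SiegelClause` discharged on an infinite certified-territory class); TALLY lens-1 ×19 + THEOREM ×21; RULE K-R53 FIXED verbatim as pre-announced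 L2834 ((i) toolkit ∪= Siegel transfer in general, ×0-as-record; (ii) open territory at m₀ = 2 := K-R52 territory ∧ live at every place incl. ℝ ∧ genus ≥ 2 not transfer-reachable, standing witness W4; (iii) payable: uniform ThinFibre 2 / a binder proved / W4 itself / a genus-≥2 territory class by a new lever / the genus-one grade uniformly — ask first; (iv) unconditional part ∪= {P : a Siegel transfer datum is typed} — today SW e, dQ e ≠ 0); lens DONE L2865; PORT GO L2866 exactly as census STAGING NOTE 12 L2863 (five parts, the Family split accepted). Port by census-1 gen 23 as `RootDecomp1KSiegelGenusOne01–05` (`--supports stmt-Schanuel-33364`; no census credit): 01 = §A the genus-one model over a field with t⁴ = 17 (Taylor data, `cW`, the point `(XE, YE)`, `equation_XE_YE`, `c₄`/`c₆`/`Δ ≠ 0`, recovery of r; section Algebra); 02 = §B valuation bounds, the max trick `val_le_one_of_eigen`, the `X_E`-stable lattice and its matrix (sections Valuation, Lattice) and §C the number field ℚ(θ), Siegel's theorem assembled inline from the three proved Literature theorems, `finite_ordinates_dyadic` / `finite_abscissae_dyadic` / finiteness of level ordinates and abscissae (section Finiteness); 03 = §D part 1: the class `SW e`, `levelFinite_SW`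 / `thinFibreAt_SW` / `bddLevelEmpty_SW` / `siegelClause_SW` for every e with `dQ e ≠ 0`, the real place (dead side / live side), up to `not_rootlessTop_SW` (section Family, first half); 04 = §D part 2: the refusals `not_decidedAt_two_SW` / `not_localAt_SW` / `not_gaussAt_SW` / …, the pinned family `sX' j = 21505j + 937`, `sE'`, `S'`, `dQ_sE'_ne_zero` uniformly, `levelFinite_S'` / `thinFibreAt_S'` / `S'_real_live`, the decided member SW(−342), the filed (withdrawn) family S j (section Family, second half — re-opened with K's own open-lines); 05 = §E TERRITORY: Δ_x(SW e) 17-Eisenstein ⇒ irreducible quartic, the resolvent certificate mod 11, `S'_territory` by tree names (section Territory). PORT EDITS: no docstring added (K documents every declaration); EIGHT one-line valuation helpers of §B PRIVATISED (`vle_add`, `vle_sub`, `vle_neg`, `vle_intCast`, `vle_natCast`, `vle_pow`, `vle_mul`, `vle_ofNat` — gate-forced: p846698 bounced `dedup.landed`, they restate `WeierstrassCurve.Affine.Point.abv_*_le_one` [Literature/NumberTheory/EllipticCurves/NeronLocalHeightGoodPlaces] and `Literature.NumberTheory.LFunctions.valuation_{int,nat}Cast_le_one`; statements and proofs kept verbatim,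 `private` added, private copies carried into later parts where used); no re-pointing, no import change, no set_option; the only structural edit is the split of `section Family` at the declaration boundary before `not_decidedAt_two_SW` (part 03 closes it with an inserted `end Family`, part 04 re-opens it with K's own 20 `open` lines ll. 661–680 verbatim; no `variable` lives in that section); provenance doc blocks + continuation headers (`noncomputable section`, `namespace`, `open Polynomial`, `open scoped Classical`) = K's own; statements and proofs VERBATIM. Rung 0 — nothing here proves Schanuel, 33364, 33363, 31077 or ThinFibre 2; everything HYPOTHESIS-FREE (the Literature inputs are proved theorems).)
-/

noncomputable section

namespace Summit.Schanuel.Schanuel.Theorems.RootDecomp1KSiegelGenusOne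

open Polynomial
open scoped Classical

/-! ### §E  TERRITORY: the `x`-discriminant `Δ_x(SW e) = D_e` (17-EISENSTEIN ⇒ ℚ-irreducible quartic: GENUS ONE, no
rational 2-torsion datum), the resolvent certificate mod 11, and the conjunction `S'_territory` by tree names -/

section Territory

open LiouvilleNumber
open scoped Nat
open Summit.Schanuel.Schanuel.Theorems.RootDecomp1KTwoBaseCell (psNumer partialSum_eq_psNumer_div coprime_psNumer
  partialSum_pos' partialSum_lt_two)
open Summit.Schanuel.Schanuel.Theorems.RootDecomp1KDegreeLadder
open Summit.Schanuel.Schanuel.Theorems.RootDecomp1KXLinear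
open Summit.Schanuel.Schanuel.Theorems.RootDecomp1KXLinearII
open Summit.Schanuel.Schanuel.Theorems.RootDecomp1KXTop
open Summit.Schanuel.Schanuel.Theorems.RootDecomp1KXAll
open Summit.Schanuel.Schanuel.Theorems.RootDecomp1KLevelFinite
open Summit.Schanuel.Schanuel.Theorems.RootDecomp1KThueMahler
open Summit.Schanuel.Schanuel.Theorems.RootDecomp1KParamThueMahler
open Summit.Schanuel.Schanuel.Theorems.RootDecomp1KLocalExponent
open Summit.Schanuel.Schanuel.Theorems.RootDecomp1KIntegrality (GaussAt gaussAt_xPolyP_iff level_identity_rat)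
open Summit.Schanuel.Schanuel.Theorems.RootDecomp1KSubspaceBranch (SepTopAt)
open Summit.Schanuel.Schanuel.Theorems.RootDecomp1KHeightGrading (BddLevelEmpty bddLevelEmpty_iff_levelFinite)
open Summit.Schanuel.Schanuel.Theorems.RootDecomp1KRunge
open Summit.Schanuel.Schanuel.Theorems.RootDecomp1KDescent
open Summit.Schanuel.Schanuel.Theorems.RootDecomp1KCubicDescent
open Summit.Schanuel.Schanuel.Theorems.RootDecomp1KOddEmpty

/-- [datum] `D_e := G² − 4e·Q = (1 − 4e)Y⁴ + 34Y³ + 255Y² − 578Y + 17(17 + 4e)`. -/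
def sD (e : ℤ) : ℤ[X] :=
  C (289 + 68 * e) + C (-578) * X + C 255 * X ^ 2 + C 34 * X ^ 3 + C (1 - 4 * e) * X ^ 4
/-- `(e : ℤ) : sC e 1 ^ 2 - 4 * sC e 0 * sC e 2 = sD e`. -/
theorem disc_eq_sD (e : ℤ) : sC e 1 ^ 2 - 4 * sC e 0 * sC e 2 = sD e := by
  simp only [sC_two, sC_one, sC_zero, vQ, sG, sD, map_add, map_mul, map_neg, map_sub, map_ofNat, map_one]
  ring
/-- `(e : ℤ) : xDisc (SW e) = sD e`. -/
theorem xDisc_SW (e : ℤ) : xDisc (SW e) = sD e := by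
  rw [xDisc, xCoeff_SW, xCoeff_SW, xCoeff_SW, disc_eq_sD]
/-- **THE STANDING WITNESS W4 IS REFUSED BY TYPE**: `Δ_x(W4) = vG² − 4(Y + 2)·vQ = Y⁶ − 4Y⁵ − 8Y⁴ + 2Y³ + 68Y + 137`
is a SEXTIC — genus TWO, outside Siegel-genus-one; the datum's degree-4 field FAILS for W4 (control D2 of `Ctrl.lean`). -/
theorem xDisc_W4P : xDisc W4P = X ^ 6 - C 4 * X ^ 5 - C 8 * X ^ 4 + C 2 * X ^ 3 + C 68 * X + C 137 := by
  rw [xDisc, W4P, xCoeff_xPolyP, xCoeff_xPolyP, xCoeff_xPolyP]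
  simp only [w4C]
  norm_num [vG, vQ]
  ring
/-- `: (xDisc W4P).natDegree = 6` (not `4`). -/
theorem natDegree_xDisc_W4P : (xDisc W4P).natDegree = 6 := by rw [xDisc_W4P]; compute_degree!
/-- `(e : ℤ) : (sD e).coeff 4 = 1 - 4 * e`. -/
theorem coeff_sD_four (e : ℤ) : (sD e).coeff 4 = 1 - 4 * e := by
  rw [sD]; simp only [coeff_add, coeff_C_mul_X_pow, coeff_C_mul_X, coeff_C]; norm_num
/-- `(e : ℤ) : (sD e).coeff 3 = 34`. -/
theorem coeff_sD_three (e : ℤ) : (sD e).coeff 3 = 34 := by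
  rw [sD]; simp only [coeff_add, coeff_C_mul_X_pow, coeff_C_mul_X, coeff_C]; norm_num
/-- `(e : ℤ) : (sD e).coeff 2 = 255`. -/
theorem coeff_sD_two (e : ℤ) : (sD e).coeff 2 = 255 := by
  rw [sD]; simp only [coeff_add, coeff_C_mul_X_pow, coeff_C_mul_X, coeff_C]; norm_num
/-- `(e : ℤ) : (sD e).coeff 1 = -578`. -/
theorem coeff_sD_one (e : ℤ) : (sD e).coeff 1 = -578 := by
  rw [sD]; simp only [coeff_add, coeff_C_mul_X_pow, coeff_C_mul_X, coeff_C]; norm_num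
/-- `(e : ℤ) : (sD e).coeff 0 = 289 + 68 * e`. -/
theorem coeff_sD_zero (e : ℤ) : (sD e).coeff 0 = 289 + 68 * e := by
  rw [sD]; simp only [coeff_add, coeff_C_mul_X_pow, coeff_C_mul_X, coeff_C]; norm_num
/-- `(e : ℤ) : (sD e).natDegree ≤ 4`. -/
theorem natDegree_sD_le (e : ℤ) : (sD e).natDegree ≤ 4 := by unfold sD; compute_degree
/-- `(e : ℤ) (he : 1 - 4 * e ≠ 0) : (sD e).natDegree = 4`. -/
theorem natDegree_sD (e : ℤ) (he : 1 - 4 * e ≠ 0) : (sD e).natDegree = 4 :=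
  le_antisymm (natDegree_sD_le e) (le_natDegree_of_ne_zero (by rw [coeff_sD_four]; exact he))
/-- `(e : ℤ) (he : 1 - 4 * e ≠ 0) : (sD e).leadingCoeff = 1 - 4 * e`. -/
theorem leadingCoeff_sD (e : ℤ) (he : 1 - 4 * e ≠ 0) : (sD e).leadingCoeff = 1 - 4 * e := by
  rw [leadingCoeff, natDegree_sD e he, coeff_sD_four]

/-- **`D_e` IS 17-EISENSTEIN whenever `e ≡ 15 (mod 17)`** (`1 − 4e ≡ 9`, `17 ∣ 34, 255, 578, 17(17 + 4e)`,
`17 + 4e ≡ 9 ≢ 0`). -/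
theorem isEisensteinAt_sD (e : ℤ) (he : (17 : ℤ) ∣ e - 15) : (sD e).IsEisensteinAt (Ideal.span {(17 : ℤ)}) := by
  have hlc : 1 - 4 * e ≠ 0 := by omega
  refine ⟨?_, fun {n} hn => ?_, ?_⟩
  · rw [leadingCoeff_sD e hlc, Ideal.mem_span_singleton]; omega
  · rw [natDegree_sD e hlc] at hn
    rw [Ideal.mem_span_singleton]
    interval_cases n
    · rw [coeff_sD_zero]; exact ⟨17 + 4 * e, by ring⟩
    · rw [coeff_sD_one]; norm_num
    · rw [coeff_sD_two]; norm_num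
    · rw [coeff_sD_three]; norm_num
  · rw [Ideal.span_singleton_pow, Ideal.mem_span_singleton, coeff_sD_zero]; omega
/-- `D_e` is PRIMITIVE for `e ≡ 15 (mod 17)` (its content divides `17 = 255 − 7·34` and `1 − 4e`, coprime). -/
theorem isPrimitive_sD (e : ℤ) (he : (17 : ℤ) ∣ e - 15) : (sD e).IsPrimitive := by
  intro r hr
  rw [C_dvd_iff_dvd_coeff] at hr
  have h4 : r ∣ 1 - 4 * e := by have := hr 4; rwa [coeff_sD_four] at this
  have h3 : r ∣ 34 := by have := hr 3; rwa [coeff_sD_three] at this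
  have h2 : r ∣ 255 := by have := hr 2; rwa [coeff_sD_two] at this
  have h17 : r ∣ 17 := by
    have h := dvd_sub h2 (dvd_mul_of_dvd_right h3 7)
    norm_num at h
    exact h
  obtain ⟨k, hk⟩ := he
  exact (show IsCoprime (17 : ℤ) (1 - 4 * e) from ⟨8 * k + 7, 2, by linear_combination (-8) * hk⟩).isUnit_of_dvd' h17 h4
/-- **`D_e` is IRREDUCIBLE in `ℤ[Y]`** for `e ≡ 15 (mod 17)` … -/
theorem irreducible_sD (e : ℤ) (he : (17 : ℤ) ∣ e - 15) : Irreducible (sD e) :=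
  (isEisensteinAt_sD e he).irreducible ((Ideal.span_singleton_prime (by norm_num)).mpr
    (Int.prime_iff_natAbs_prime.mpr (by norm_num))) (isPrimitive_sD e he)
    (by rw [natDegree_sD e (by omega)]; norm_num)
/-- **… hence IRREDUCIBLE OVER `ℚ`** (Gauss): the quartic `v² = D_e(Y)` is a smooth GENUS-ONE curve with NO rational
Weierstrass point among the branch points. -/
theorem irreducible_sD_rat (e : ℤ) (he : (17 : ℤ) ∣ e - 15) : Irreducible ((sD e).map (Int.castRingHom ℚ)) :=
  (IsPrimitive.Int.irreducible_iff_irreducible_map_cast (isPrimitive_sD e he)).mp (irreducible_sD e he)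
/-- `(j : ℕ) : xDisc (S' j) = sD (sE' j)`. -/
theorem xDisc_S' (j : ℕ) : xDisc (S' j) = sD (sE' j) := xDisc_SW _
/-- **THE K-R51 `k = 2` KEY, TYPED uniformly in `j`: `Δ_x(S' j)` is a ℚ-IRREDUCIBLE QUARTIC (degree `4 ≡ 0 mod 4`:
GENUS ONE exactly; no ℚ-rational root, so no 2-descent datum of node 19's record).** -/
theorem irreducible_xDisc_S' (j : ℕ) :
    Irreducible ((xDisc (S' j)).map (Int.castRingHom ℚ)) ∧ (xDisc (S' j)).natDegree = 4 ∧ (xDisc (S' j)).natDegree % 4 = 0 := by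
  have he := dvd_sE'_sub_fifteen j
  rw [xDisc_S', natDegree_sD _ (by omega)]
  exact ⟨irreducible_sD_rat _ he, rfl, rfl⟩

/-- [datum] the CUBIC RESOLVENT of `D_e = aY⁴ + bY³ + cY² + dY + f` (roots `a²(rᵢrⱼ + rₖrₗ)`; monic, integral):
`z³ − ac·z² + (a²bd − 4a³f)·z − (a³b²f − 4a⁴cf + a⁴d²)`. -/
def sRes (e : ℤ) : ℤ[X] :=
  X ^ 3 - C ((1 - 4 * e) * 255) * X ^ 2 + C ((1 - 4 * e) ^ 2 * 34 * (-578) - 4 * (1 - 4 * e) ^ 3 * (289 + 68 * e)) * X -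
    C ((1 - 4 * e) ^ 3 * 34 ^ 2 * (289 + 68 * e) - 4 * (1 - 4 * e) ^ 4 * 255 * (289 + 68 * e) +
      (1 - 4 * e) ^ 4 * (-578) ^ 2)
/-- **RESOLVENT CERTIFICATE (census key `j2rat NONE`, typed arithmetic, HONEST label): the monic integral cubic
resolvent of `Δ_x(S' j)` has NO ROOT modulo 11, uniformly in `j`** (hence no rational root: no ℚ-rational `2 + 2`
partition of the four branch points). -/
theorem sRes_no_root_mod_eleven (j : ℕ) (z : ZMod 11) : aeval z (sRes (sE' j)) ≠ 0 := by
  obtain ⟨k, hk⟩ := dvd_sE'_sub_ten j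
  have he : sE' j = 11 * k + 10 := by omega
  rw [he, sRes]
  simp only [map_sub, map_add, map_mul, map_pow, aeval_X, aeval_C, algebraMap_int_eq, Int.coe_castRingHom]
  push_cast
  simp only [show (11 : ZMod 11) = 0 from by decide, zero_mul, zero_add]
  revert z
  decide

/-- **THE INFINITE CLASS `S' j` OF OPEN-TERRITORY PAIRS DECIDED HYPOTHESIS-FREE BY SIEGEL'S THEOREM (a theorem of the
tree) — TERRITORY, THE CERTIFICATES AND THE THEOREMS, uniformly in `j`, by tree names:** `x`-degree 2, `Y`-degree
`4 = 2·xdeg`, top `Q = Y⁴ − 17` ℚ-IRREDUCIBLE of FULL degree with a `ℚ₂`-root and no rational root, separable,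
`eTop = 0`, rate 1 typed, `¬ DecidedAt 2`, `¬ LocalAt 2`, `∀ m₀ ¬ GaussAt m₀`, `¬ XLinTM`, `¬ XLinearLt`, not x-linear /
two-term / norm shape / `CB` / `VW`, `3 ≤ thinThreshold`, `SepTopAt 2` (HONEST «binder bypassed, not proved») ∧ the
K-R51 `k = 2` key (`Δ_x` a ℚ-irreducible QUARTIC: genus one) ∧ the resolvent key mod 11 ∧ **LOCALLY LIVE**: the
anchor point `(X_j, 3)`, `¬ OddEmptyAt ℓ` and `¬ TangentEmptyAt ℓ` at EVERY `ℓ` (node 21's engines refused) ∧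
**finitely many pointed levels ∧ finitely many level ordinates ∧ `LevelFinite` ∧ `BddLevelEmpty` ∧ `ThinFibreAt m₀ (S' j)`
for EVERY `m₀`** ∧ the anchor point is SMOOTH (`HasDerivAt … (128X_j + 43) ∧ 128X_j + 43 ≠ 0`) ∧ **REAL-LIVE at EVERY
level** (`∀ N, ∃ r : ℝ, S′_j(s_N, r) = 0`) ∧ finitely many rational points with dyadic abscissa. -/
theorem S'_territory (j : ℕ) :
    xdeg (S' j) = 2 ∧ (S' j).natDegree = 4 ∧ topX (S' j) = vQ ∧
      Irreducible ((topX (S' j)).map (Int.castRingHom ℚ)) ∧ (topX (S' j)).natDegree = (S' j).natDegree ∧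
      ¬ (S' j).natDegree < 2 * xdeg (S' j) ∧
      (∃ z : ℚ_[2], aeval z (topX (S' j)) = 0) ∧ (∀ q : ℚ, aeval q (topX (S' j)) ≠ 0) ∧
      ((topX (S' j)).map (Int.castRingHom ℚ)).Separable ∧ eTop (S' j) = 0 ∧
      (∀ (K : Type) [Field K] [CharZero K] (β : K), aeval β (topX (S' j)) = 0 → aeval β (xCoeff (S' j) 1) ≠ 0) ∧
      ¬ DecidedAt 2 (S' j) ∧ ¬ LocalAt 2 (S' j) ∧ (∀ m₀, ¬ GaussAt m₀ (S' j)) ∧ ¬ XLinTM (S' j) ∧ ¬ XLinearLt (S' j) ∧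
      (∀ A B, S' j ≠ xLinP A B) ∧ (∀ k B A, S' j ≠ twoTermP k B A) ∧ (∀ g q n D, S' j ≠ normShapeCurve g q n D) ∧
      (∀ h₁ h₀ l₁ l₀, S' j ≠ CB h₁ h₀ l₁ l₀) ∧ (∀ l, S' j ≠ VW l) ∧
      3 ≤ thinThreshold (S' j) ∧ SepTopAt 2 (S' j) ∧
      xDisc (S' j) = sD (sE' j) ∧
      Irreducible ((xDisc (S' j)).map (Int.castRingHom ℚ)) ∧ (xDisc (S' j)).natDegree = 4 ∧
      (xDisc (S' j)).natDegree % 4 = 0 ∧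
      (∀ z : ZMod 11, aeval z (sRes (sE' j)) ≠ 0) ∧
      bev (S' j) ((sX' j : ℚ) : ℝ) (((3 : ℚ)) : ℝ) = 0 ∧
      (∀ ℓ, ¬ OddEmptyAt ℓ (S' j)) ∧ (∀ ℓ, ¬ TangentEmptyAt ℓ (S' j)) ∧
      {N : ℕ | ∃ r : ℚ, bev (S' j) (partialSum 2 N) r = 0}.Finite ∧
      {r : ℚ | ∃ N : ℕ, bev (S' j) (partialSum 2 N) r = 0}.Finite ∧
      LevelFinite (S' j) ∧ BddLevelEmpty (S' j) ∧ (∀ m₀, ThinFibreAt m₀ (S' j)) ∧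
      (HasDerivAt (fun x => bev (S' j) x (((3 : ℚ)) : ℝ)) (((128 * sX' j + 43 : ℤ)) : ℝ) ((sX' j : ℚ) : ℝ) ∧
        128 * sX' j + 43 ≠ 0) ∧
      (∀ N, ∃ r : ℝ, bev (S' j) (partialSum 2 N) r = 0) ∧
      {p : ℚ × ℚ | bev (S' j) p.1 p.2 = 0 ∧ IsDyadic p.1}.Finite := by
  refine ⟨xdeg_SW _, natDegree_SW _, topX_SW _, ?_, natDegree_topX_SW _, not_natDegree_SW_lt _, ?_, ?_, ?_, eTop_SW _,
    aeval_xCoeff_one_ne_zero_of_root_SW _, not_decidedAt_two_SW _, not_localAt_SW _ le_rfl, not_gaussAt_SW _,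
    not_xLinTM_SW _, not_xLinearLt_SW _, SW_ne_xLinP _, SW_ne_twoTermP _, SW_ne_normShapeCurve _, SW_ne_CB _,
    SW_ne_VW _, three_le_thinThreshold _, sepTopAt_two_SW _, xDisc_S' j, (irreducible_xDisc_S' j).1,
    (irreducible_xDisc_S' j).2.1, (irreducible_xDisc_S' j).2.2, sRes_no_root_mod_eleven j, bev_S'_anchor j,
    not_oddEmptyAt_S' j, not_tangentEmptyAt_S' j, finite_pointed_levels_S' j, finite_ordinates_S' j, levelFinite_S' j,
    bddLevelEmpty_S' j, thinFibreAt_S' j, hasDerivAt_S'_anchor j, S'_real_live j, finite_dyadicPoints_S' j⟩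
  · rw [S', topX_SW]; exact irreducible_vQ_rat
  · rw [S', topX_SW]; exact exists_padic_root_vQ
  · rw [S', topX_SW]; exact aeval_vQ_ne_zero_rat
  · rw [S', topX_SW]; exact separable_vQ_rat

/-- the NAMED MEMBERS `S' 0 = (Y⁴−17)x² + (Y²+17Y−17)x − 56230307` (`X₀ = 937`) and `S' 1 = … − 32234140302`
(`X₁ = 22442`) — census rows «node22 S′ X=937 / S′ X=22442» (LIVENESS-v23). -/
theorem sE'_zero : sE' 0 = -56230307 := by decide
/-- `: sE' 1 = -32234140302`. -/
theorem sE'_one : sE' 1 = -32234140302 := by decide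
/-- `: sX' 0 = 937 ∧ sX' 1 = 22442`. -/
theorem sX'_zero_one : sX' 0 = 937 ∧ sX' 1 = 22442 := by decide
/-- `(m₀ : ℕ) : ThinFibreAt m₀ (S' 0)`. -/
theorem thinFibreAt_S'0 (m₀ : ℕ) : ThinFibreAt m₀ (S' 0) := thinFibreAt_S' 0 m₀
/-- `(m₀ : ℕ) : ThinFibreAt m₀ (S' 1)`. -/
theorem thinFibreAt_S'1 (m₀ : ℕ) : ThinFibreAt m₀ (S' 1) := thinFibreAt_S' 1 m₀
/-- `: LevelFinite (S' 0) ∧ LevelFinite (S' 1)`. -/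
theorem levelFinite_S'0_S'1 : LevelFinite (S' 0) ∧ LevelFinite (S' 1) := ⟨levelFinite_S' 0, levelFinite_S' 1⟩
/-- `: LevelFinite (SW (-342))` — the decided member at `X = 2` (anchor `(2, 3)`, `e = −64·4 − 43·2 = −342`; census row
«node22 S′ X=2»; OFF the pinned progression, decided by the same class theorem: `dQ (−342) ≠ 0` by `decide`). -/
theorem levelFinite_SW_neg_342 : LevelFinite (SW (-342)) := levelFinite_SW (-342) (by decide)
/-- `(m₀ : ℕ) : ThinFibreAt m₀ (SW (-342))`. -/
theorem thinFibreAt_SW_neg_342 (m₀ : ℕ) : ThinFibreAt m₀ (SW (-342)) := thinFibreAt_SW (-342) (by decide) m₀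
/-- `(N : ℕ) : ∃ r : ℝ, bev (SW (-342)) (partialSum 2 N) r = 0` — the member at `X = 2` is real-live at every level. -/
theorem SW_neg_342_real_live (N : ℕ) : ∃ r : ℝ, bev (SW (-342)) (partialSum 2 N) r = 0 :=
  exists_real_root_SW _ (by decide) (half_le_partialSum_cb N)
/-- `: bev (SW (-342)) (((2 : ℤ) : ℚ) : ℝ) (((3 : ℚ)) : ℝ) = 0` — its anchor point `(2, 3)`. -/
theorem bev_SW_neg_342_anchor : bev (SW (-342)) (((2 : ℤ) : ℚ) : ℝ) (((3 : ℚ)) : ℝ) = 0 := by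
  rw [bev_SW]; push_cast; norm_num
/-- **WHY THE RECORD COULD NOT (typed on `S' 0`)**: `¬ DecidedAt 2`, `¬ LocalAt 2`, `¬ GaussAt 2`, `¬ XLinTM`, top
ℚ-irreducible of full degree (no degree-ladder / Ridout margin), outside node 12's height shape, `Δ_x` a ℚ-irreducible
QUARTIC (genus one, no rational 2-torsion datum of node 19), not a `CB` of node 20, `¬ OddEmptyAt ℓ` and
`¬ TangentEmptyAt ℓ` ∀ `ℓ` (node 21; the anchor point `(937, 3)`); AND the theorems: finitely many pointed levels,
`LevelFinite`, `ThinFibreAt 2` and `ThinFibreAt 0`, REAL-LIVE at every level, finitely many dyadic-abscissa points. -/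
theorem S'0_territory : ¬ DecidedAt 2 (S' 0) ∧ ¬ LocalAt 2 (S' 0) ∧ ¬ GaussAt 2 (S' 0) ∧ ¬ XLinTM (S' 0) ∧
    Irreducible ((topX (S' 0)).map (Int.castRingHom ℚ)) ∧ (topX (S' 0)).natDegree = (S' 0).natDegree ∧
    ¬ (S' 0).natDegree < 2 * xdeg (S' 0) ∧ Irreducible ((xDisc (S' 0)).map (Int.castRingHom ℚ)) ∧
    (xDisc (S' 0)).natDegree = 4 ∧ (∀ h₁ h₀ l₁ l₀, S' 0 ≠ CB h₁ h₀ l₁ l₀) ∧ (∀ ℓ, ¬ OddEmptyAt ℓ (S' 0)) ∧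
    (∀ ℓ, ¬ TangentEmptyAt ℓ (S' 0)) ∧ bev (S' 0) (((937 : ℤ) : ℚ) : ℝ) (((3 : ℚ)) : ℝ) = 0 ∧
    {N : ℕ | ∃ r : ℚ, bev (S' 0) (partialSum 2 N) r = 0}.Finite ∧ LevelFinite (S' 0) ∧ ThinFibreAt 2 (S' 0) ∧
    ThinFibreAt 0 (S' 0) ∧ (∀ N, ∃ r : ℝ, bev (S' 0) (partialSum 2 N) r = 0) ∧
    {p : ℚ × ℚ | bev (S' 0) p.1 p.2 = 0 ∧ IsDyadic p.1}.Finite := by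
  obtain ⟨-, -, -, h4, h5, h6, -, -, -, -, -, h12, h13, h14, h15, -, -, -, -, h20, -, -, -, -, h25, h26, -, -, h29,
    h30, h31, h32, -, h34, -, h36, -, h38, h39⟩ := S'_territory 0
  exact ⟨h12, h13, h14 2, h15, h4, h5, h6, h25, h26, h20, h30, h31, by simpa [sX'] using h29, h32, h34, h36 2, h36 0,
    h38, h39⟩

end Territory

end Summit.Schanuel.Schanuel.Theorems.RootDecomp1KSiegelGenusOne

end
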